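import Summits.AtomisticToContinuum.HydrodynamicLimit.Theses.InformationPercolationEngine
import Summits.AtomisticToContinuum.HydrodynamicLimit.Theorems.InformationPercolationEnginePercolationClosesChaosPredictableProjection
import Literature.MathematicalPhysics.KineticTheory.VelocityBlindPlacement
import HarnessLib

/-!
# Vocabulary of the line `equilibrium-forecast-chain-rule` for the crux `InformationPercolationEngine.PercolationClosesChaos`
(stmt-AtomisticToContinuum-15178; rank 4 of route `InformationPercolationEngine`) — part 1: objects

Definitions-only support file (`--supports stmt-AtomisticToContinuum-15178`) of the lead prover of the line
(`Cruxes/PercolationClosesChaos/Lines/equilibrium_forecast_chain_rule.lean`, skeleton v2 registered on the item with the seven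
stubs `stub_mce`, `stub_localCountUI`, `stub_noMesoscopicOscillation`, `stub_revealedDefectStability`,
`stub_cesaroLocalEquilibrium`, `stub_forecastTransfer`, `stub_docking`; `stub_predictableProjection` already landed as
`Theorems.EquilibriumForecastLine.stub_predictableProjection`). It makes the line's vocabulary IMPORTABLE so that each registered
stub can land in its own sorry-free Theorems file with the registered signature verbatim (the skeleton's §0–§4 and the target's
mollified pair field `targetPm`, byte-for-byte, moved from namespace `…Cruxes.PercolationClosesChaos.EquilibriumForecastChainRule` to
this one; the seven typed `Prop` statements of §5 are the companion file `…ForecastStatements.lean`). Nothing is asserted here: every `def` is an object of the line (kinetic frame, realised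
cell-pair statistics of a step, coarse one-body functionals of a cell, the mesoscopic filtration) and the three `def … : Prop`s
(`PredictableProjection` — PROVED, witness `stub_predictableProjection`; the order predicates `cellLT`; the cutoffs `Dense`,
`Regular`, `GoodUnit`) are predicates the stubs prove or consume, never hypotheses taken as facts.

The mathematics (idea card `Cruxes/PercolationClosesChaos/Ideas/equilibrium-forecast-chain-rule.md`, line card
`Lines/equilibrium-forecast-chain-rule.md`, lead reports in `Lines/`): spend the entropy budget `H(LG | G_N) ≤ K(N+1)` through the
Kullback–Leibler chain rule along a nested MESOSCOPIC filtration of the deterministic hard-sphere flow (kinetic cells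
`Torus.coarseCell (c ℓ_N)`, steps `Δ_N = c ℓ_N`, per-sphere ordered lists of reduced collision records, revealed sequentially over
cells), so that the `LG`-forecast of every coarse increment equals its `G_N`-forecast up to an `L¹` remainder
(`PredictableProjection`, the lever); kinetic-cell chaos of the evolved law then reduces to a large-deviation statement about the
INVARIANT law (`MesoConditionalEquidistribution`, companion file) plus LG-side tail/regularity inputs, and docks into the route
target `ContactChaos` through the kinetic statements of the companion file.
-/

noncomputable section

open MeasureTheory Set Filter Topology
open scoped ENNReal BigOperators Classical
open Literature.Analysis.FluidPDE Literature.MathematicalPhysics.KineticTheory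
open Literature.MathematicalPhysics.KineticTheory.VelocityBlindPlacement

namespace Summit.AtomisticToContinuum.HydrodynamicLimit.Theorems.EquilibriumForecastLine

/-! ## §0 The abstract engine: predictable projection along a filtration with countable alphabet -/

/-- The past σ-algebra `𝓕_k = σ(Y_0, …, Y_k)` of a sequence of observations with values in an alphabet `S` carrying the
DISCRETE σ-algebra (the alphabet is countable in every use). -/
abbrev pastSigma {Ω S : Type*} (Y : ℕ → Ω → S) (k : ℕ) : MeasurableSpace Ω :=
  MeasurableSpace.comap (fun ω => fun j : Fin (k + 1) => Y j ω) ⊤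

/-- **`PredictableProjection`** (the lever; abstract information theory, provable now). For probability laws `μ, ν` on
`Ω` with `KL(μ ‖ ν) < ∞`, observations `Y_k : Ω → S` into a countable alphabet generating the filtration `𝓕_k`, and
increments `X_k` that are `𝓕_{k+1}`-measurable and bounded by `C`: the `μ`-predictable and the `ν`-predictable compensators
of `Σ_{k<K} X_k` differ in `L¹(μ)` by at most `C √(2K · KL(μ ‖ ν))`:
`Σ_{k<K} E_μ |E_μ[X_k | 𝓕_k] − E_ν[X_k | 𝓕_k]| ≤ C √(2 K KL(μ‖ν))`.
Proof sketch: on an atom `A` of `𝓕_k` with `μ(A) > 0` (hence `ν(A) > 0`, `μ ≪ ν`), the two conditional expectations are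
elementary averages of `g(y_{≤k}, ·)` against the conditional laws of `Y_{k+1}`, so their difference is
`≤ 2C · TV ≤ C √(2 KL_A)` (Pinsker); Cauchy–Schwarz/Jensen over `k` and atoms; the chain rule
`Σ_k E_μ KL_k = KL(μ_{Y_{≤K}} ‖ ν_{Y_{≤K}}) ≤ KL(μ ‖ ν)` (`InformationTheory.klDiv_compProd_eq_add` iterated, data
processing `klDiv_map_le`). Degenerate cases (`K = 0`, `C = 0`, `μ = ν`) hold trivially. -/
def PredictableProjection : Prop :=
  ∀ {Ω : Type} [MeasurableSpace Ω] {S : Type} [Countable S]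
    (μ ν : Measure Ω) [IsProbabilityMeasure μ] [IsProbabilityMeasure ν]
    (Y : ℕ → Ω → S) (X : ℕ → Ω → ℝ) (C : ℝ) (K : ℕ),
    (∀ k, pastSigma Y k ≤ ‹MeasurableSpace Ω›) →
    (∀ k, Measurable[pastSigma Y (k + 1)] (X k)) →
    (∀ k ω, |X k ω| ≤ C) →
    InformationTheory.klDiv μ ν ≠ ∞ →
    ∑ k ∈ Finset.range K,
        ∫ ω, |MeasureTheory.condExp (pastSigma Y k) μ (X k) ω
              - MeasureTheory.condExp (pastSigma Y k) ν (X k) ω| ∂μ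
      ≤ C * Real.sqrt (2 * K * (InformationTheory.klDiv μ ν).toReal)

/-- `PredictableProjection` HOLDS: it is the registered stub S1, landed by lead a2's wave-1 worker as
`Theorems.EquilibriumForecastLine.stub_predictableProjection` (p124443; sharp countable Pinsker p123768, partition data
processing p123852, one filtration step p124177). Recorded here so that the `Prop` is a proved predicate of the vocabulary and
not a named fact. -/
theorem predictableProjection_holds : PredictableProjection := by
  intro Ω _ S _ μ ν _ _ Y X C K hle hX hC hkl
  exact stub_predictableProjection μ ν Y X C K hle hX hC hkl

/-! ## §1 Kinetic frame: cells and steps of `c` mean free paths, velocity bins, lexicographic cell order -/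

/-- Index of a kinetic cell (`Torus.coarseCell`) and of a velocity bin: an integer vector. -/
abbrev Cell : Type := Fin 3 → ℤ

/-- The torus geometry of the crux. -/
abbrev G3 : Geometry (Fin 3) T3 := Torus.geometry (Fin 3)

/-- Step duration `Δ_N = c ℓ_N` (thermal speed `1`: `c` mean free times). -/
def stepLen (c σ : ℝ) (N : ℕ) : ℝ := c * meanFreePath σ N

/-- Expected number of spheres in a kinetic cell of side `c ℓ_N` at unit density: `n̄ = (N+1)(cℓ_N)³ = c³/(π³σ⁶)`
(`card_mul_meanFreePath_cube`), `N`-independent. -/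
def cellCount (c σ : ℝ) (N : ℕ) : ℝ := ((N : ℝ) + 1) * (c * meanFreePath σ N) ^ 3

/-- The homogeneous INVARIANT law `G_N` (`localGibbsLaw` with constant profiles `1, 0, 1`; the reference law of crux 2). -/
def eqLaw (σ : ℝ) (N : ℕ) (Φ : Flow σ N) : Measure (Phase N) :=
  localGibbsLaw σ (fun _ => 1) (fun _ => 0) (fun _ => 1) N Φ

/-- The kinetic cell of a point: `Torus.coarseCell (c ℓ_N)`. -/
def cellOf (c σ : ℝ) (N : ℕ) (x : T3) : Cell := Torus.coarseCell (c * meanFreePath σ N) x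

/-- The centre of the kinetic cell `q` (projected to the torus). -/
def cellCentre (c σ : ℝ) (N : ℕ) (q : Cell) : T3 :=
  Literature.Analysis.FunctionSpaces.Torus.proj
    (WithLp.toLp 2 fun m : Fin 3 => (((q m : ℤ) : ℝ) + 2⁻¹) * (c * meanFreePath σ N))

/-- Velocity bin of width `b`: `(⌊v_m / b⌋)_m`. -/
def velBin (b : ℝ) (v : V3) : Cell := fun m => ⌊v m / b⌋

/-- Strict lexicographic order on cell indices (the revelation order inside a step). -/
def cellLT (p q : Cell) : Prop :=
  p 0 < q 0 ∨ (p 0 = q 0 ∧ (p 1 < q 1 ∨ (p 1 = q 1 ∧ p 2 < q 2)))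

/-- Lexicographic minimum of two cells: the OWNER of a collision between spheres starting the step in them. -/
def cellMin (p q : Cell) : Cell := if cellLT q p then q else p

/-- Flux-angular average of a mark test over impact vectors, `∫_{S²} Ξ(ω, v, w) ((w − v)·ω)₊ dω` (the target's `Θ`). -/
def fluxAvg (Ξ : V3 × V3 × V3 → ℝ) (v w : V3) : ℝ :=
  ∫ ω : Metric.sphere (0 : V3) 1, Ξ ((ω : V3), v, w) * hardSphereKernel (w, v) ω ∂sphereMeasure

/-- The pre-collisional mark `(ω, v_i⁻, v_j⁻)` of an ordered contact pair `(i, j)` read off the (post-collisional,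
right-continuous) configuration — literally the target's `(ε⁻¹ sepVec, pv)`. -/
def markOf (N : ℕ) (ε : ℝ) (w : Phase N) (i j : Fin (N + 1)) : V3 × V3 × V3 :=
  (ε⁻¹ • G3.sepVec (w i).1 (w j).1, reflectVel (G3.sepVec (w i).1 (w j).1) ((w i).2, (w j).2))

/-! ## §2 Realised cell-pair statistics of a step (crisp cells, spheres labelled by their START cell) -/

/-- Time window of step `k`: `(kΔ, (k+1)Δ]`. -/
def stepWindow (c σ : ℝ) (N : ℕ) (k : ℕ) : Set ℝ :=
  Set.Ioc ((k : ℝ) * stepLen c σ N) (((k : ℝ) + 1) * stepLen c σ N)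

/-- START CELL of sphere `i` for step `k`: its kinetic cell at time `kΔ`. -/
def startCell (c σ : ℝ) (N : ℕ) (Φ : Flow σ N) (k : ℕ) (z : Phase N) (i : Fin (N + 1)) : Cell :=
  cellOf c σ N ((Φ.flow ((k : ℝ) * stepLen c σ N) z) i).1

/-- CELL-PAIR COLLISION STATISTIC of step `k`: `(n̄ c)⁻¹ Σ_{collisions in the step} Σ_{ordered contact pairs (i,j) with
start cells (q, q')} Ψ(ω, v_i⁻, v_j⁻)` (marks = the target's; normalised so that a normally populated cell gives `O(1)`:
`≍ n̄` spheres × `≍ c` collisions per sphere per step). -/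
def collPair (Ψ : V3 × V3 × V3 → ℝ) (c σ : ℝ) (N : ℕ) (Φ : Flow σ N) (k : ℕ) (q q' : Cell) (z : Phase N) : ℝ :=
  (cellCount c σ N * c)⁻¹ *
    Φ.collisionPairSum (stepWindow c σ N k)
      (fun _ w i j =>
        if startCell c σ N Φ k z i = q ∧ startCell c σ N Φ k z j = q' then Ψ (markOf N (hsDiameter σ N) w i j) else 0) z

/-- CELL-PAIR PAIR-LAW STATISTIC of step `k`: `n̄⁻² Σ_{i ≠ j, start cells (q,q')} fluxAvg Ξ (v_i(kΔ), v_j(kΔ))` — the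
flux-weighted product of the two start-cell populations' OWN (fine) velocity laws AT THE STEP START tested against `Ξ` (a
function of the configuration at time `kΔ`, hence of the past: the increment of unit `q` is measurable as soon as the records
of the spheres starting in `q` are revealed; on a good — near-Maxwellian, homogeneous — unit the population law is
quasi-stationary over the step). -/
def pairPair (Ξ : V3 × V3 × V3 → ℝ) (c σ : ℝ) (N : ℕ) (Φ : Flow σ N) (k : ℕ) (q q' : Cell) (z : Phase N) : ℝ :=
  (cellCount c σ N ^ 2)⁻¹ *
    ∑ i : Fin (N + 1), ∑ j : Fin (N + 1),
      (if i ≠ j ∧ startCell c σ N Φ k z i = q ∧ startCell c σ N Φ k z j = q'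
        then fluxAvg Ξ ((Φ.flow ((k : ℝ) * stepLen c σ N) z) i).2 ((Φ.flow ((k : ℝ) * stepLen c σ N) z) j).2 else 0)

/-- RELATIVE CELL-PAIR DEFECT: `collPair Ψ / collPair 1 − pairPair Ψ / pairPair 1` — the collision average of the mark test over
the `(q, q')`-collisions of the step minus its average against flux ⊗ (own pair law of the two start-cell populations):
rate-free and SELF-REFERENTIAL (zero in the forecast mean under chaos for ANY pair of populations, Maxwellian or not, up to the
`O(φ·(f − M))` dynamical correction); junk `0 − ratio` when there is no `(q, q')`-collision (then it carries no weight below). -/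
def relDefect (Ψ : V3 × V3 × V3 → ℝ) (c σ : ℝ) (N : ℕ) (Φ : Flow σ N) (k : ℕ) (q q' : Cell) (z : Phase N) : ℝ :=
  collPair Ψ c σ N Φ k q q' z / collPair (fun _ => 1) c σ N Φ k q q' z -
    pairPair Ψ c σ N Φ k q q' z / pairPair (fun _ => 1) c σ N Φ k q q' z

/-- OWNED COLLISION COUNT of unit `q` at step `k` (ordered contact pairs whose lex-min start cell is `q`), normalised by `n̄ c`;
equals `collPair 1 (q,q) + Σ_{q' >_lex q} (collPair 1 (q,q') + collPair 1 (q',q))`. -/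
def ownedCount (c σ : ℝ) (N : ℕ) (Φ : Flow σ N) (k : ℕ) (q : Cell) (z : Phase N) : ℝ :=
  (cellCount c σ N * c)⁻¹ *
    Φ.collisionPairSum (stepWindow c σ N k)
      (fun _ _ i j => if cellMin (startCell c σ N Φ k z i) (startCell c σ N Φ k z j) = q then (1 : ℝ) else 0) z

/-- ROW COLLISION COUNT of unit `q` at step `k` (v2, wave-1 S7 audit R2a): ordered contact pairs `(i, j)` of the step whose FIRST
member starts the step in `q`, normalised by `n̄ c` (`= Σ_{q'} collPair 1 (q, q')`); every ordered contact pair is owned by the start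
cell of one of its members and appears in both orders, so `ownedCount q ≤ 2 · (Σ over the two members' rows)`; a sphere with more than
`n̄cT` collisions in the step forces `rowCount > T` for ITS start cell — the per-particle count control the docking's in-step
displacement bound consumes, which lex-min ownership does not give. -/
def rowCount (c σ : ℝ) (N : ℕ) (Φ : Flow σ N) (k : ℕ) (q : Cell) (z : Phase N) : ℝ :=
  (cellCount c σ N * c)⁻¹ *
    Φ.collisionPairSum (stepWindow c σ N k)
      (fun _ _ i _ => if startCell c σ N Φ k z i = q then (1 : ℝ) else 0) z

/-- DEFECT OF THE OWNED UNIT `q` at step `k`: the COLLISION-WEIGHTED MEAN of `|relDefect Ψ|` over the ordered cell pairs it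
owns (`(q, q)`, and `(q, q')`, `(q', q)` for `q' >_lex q`; finitely many non-zero terms), so that sparsely colliding cell pairs
weigh what they collide. On a GOOD unit (`unitDefect ≤ η`): `Σ_pairs |collPair Ψ − collPair 1 · (pairPair Ψ / pairPair 1)| ≤ η · ownedCount`. -/
def unitDefect (Ψ : V3 × V3 × V3 → ℝ) (c σ : ℝ) (N : ℕ) (Φ : Flow σ N) (k : ℕ) (q : Cell) (z : Phase N) : ℝ :=
  (ownedCount c σ N Φ k q z)⁻¹ *
    ∑' q' : Cell,
      if q' = q then collPair (fun _ => 1) c σ N Φ k q q z * |relDefect Ψ c σ N Φ k q q z|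
      else if q = cellMin q q' then
        collPair (fun _ => 1) c σ N Φ k q q' z * |relDefect Ψ c σ N Φ k q q' z| +
          collPair (fun _ => 1) c σ N Φ k q' q z * |relDefect Ψ c σ N Φ k q' q z|
      else 0

/-- The INCREMENT of the line: truncated collision weight of the owned unit times the indicator that its defect exceeds `η`
(`∈ [0, T]`, a function of the step's collision marks and of the start-cell velocity populations). -/
def badWeight (Ψ : V3 × V3 × V3 → ℝ) (η T c σ : ℝ) (N : ℕ) (Φ : Flow σ N) (k : ℕ) (q : Cell) (z : Phase N) : ℝ :=
  min (ownedCount c σ N Φ k q z) T * (if η < unitDefect Ψ c σ N Φ k q z then 1 else 0)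

/-- Number of complete steps in `[0, τ]`: `K_N = ⌊τ / Δ_N⌋ ≍ τ (N+1)^{1/3}/c → ∞`. -/
def numSteps (c σ : ℝ) (N : ℕ) (τ : ℝ) : ℕ := ⌊τ / stepLen c σ N⌋₊

/-- UNIT AVERAGE of a (step, cell)-indexed quantity: `K_N⁻¹ (cℓ_N)³ Σ_{k < K_N} Σ_q F k q` (cell volume × number of cells = 1). -/
def unitAvg (c σ : ℝ) (N : ℕ) (τ : ℝ) (F : ℕ → Cell → ℝ) : ℝ :=
  ((numSteps c σ N τ : ℝ))⁻¹ * (c * meanFreePath σ N) ^ 3 *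
    ∑ k ∈ Finset.range (numSteps c σ N τ), ∑' q : Cell, F k q

/-- The TARGET's `r`-mollified pair-flux field read through its time mollifier: `Pm (Θ Ξ) z s₀ x₀ =
∫_{[0,τ]} bt(s − s₀) ∫∫ bx(x, x₀) bx(y, x₀) Θ_Ξ(v, w) d(μ_s ⊗ μ_s) ds` with `bx = bump r`, `bt(a) = r⁻¹(1 − |a|/r)₊` — copied from
`ContactChaos`'s `let`-block (`A_r = targetPm 1`, `B^Ξ_r = targetPm Ξ`), so that the docking meets the target's reference and not
an instantaneous one (Disproof F18 e, `docking_reference_gap` p108600). -/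
def targetPm (Ξ : V3 × V3 × V3 → ℝ) (r τ σ : ℝ) (N : ℕ) (Φ : Flow σ N) (z : Phase N) (s₀ : ℝ) (x₀ : T3) : ℝ :=
  ∫ s in Set.Icc (0 : ℝ) τ, (r⁻¹ * max (1 - |s - s₀| / r) 0) *
    ∫ p, bump r p.1.1 x₀ * bump r p.2.1 x₀ * fluxAvg Ξ p.1.2 p.2.2
      ∂((empiricalMeasure (Φ.flow s z)).prod (empiricalMeasure (Φ.flow s z)))

/-! ## §3 Coarse one-body functionals of a cell at a step start (density, smoothed velocity law, relative entropy, homogeneity) -/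

/-- Population of cell `q` in the configuration `w`. -/
def pop (c σ : ℝ) (N : ℕ) (w : Phase N) (q : Cell) : Finset (Fin (N + 1)) :=
  Finset.univ.filter fun i => cellOf c σ N (w i).1 = q

/-- Population of the `4cℓ`-NEIGHBOURHOOD of cell `q` (cells whose centres are within `4cℓ` of the centre of `q`, torus distance). -/
def nbhd (c σ : ℝ) (N : ℕ) (w : Phase N) (q : Cell) : Finset (Fin (N + 1)) :=
  Finset.univ.filter fun i =>
    Torus.euclidDist (cellCentre c σ N (cellOf c σ N (w i).1)) (cellCentre c σ N q) ≤ 4 * (c * meanFreePath σ N)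

/-- Gaussian-smoothed empirical velocity law of a population (kernel width `ϑ`; junk `0` for an empty population). -/
def kde {N : ℕ} (ϑ : ℝ) (w : Phase N) (P : Finset (Fin (N + 1))) (v : V3) : ℝ :=
  ((P.card : ℝ))⁻¹ * ∑ i ∈ P, localMaxwellian 1 (ϑ ^ 2) (w i).2 v

/-- Mean velocity of a population. -/
def meanVel {N : ℕ} (w : Phase N) (P : Finset (Fin (N + 1))) : V3 :=
  ((P.card : ℝ))⁻¹ • ∑ i ∈ P, (w i).2

/-- Temperature (one third of the velocity variance) of a population. -/
def temp {N : ℕ} (w : Phase N) (P : Finset (Fin (N + 1))) : ℝ :=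
  ((P.card : ℝ))⁻¹ * ∑ i ∈ P, ‖(w i).2 - meanVel w P‖ ^ 2 / 3

/-- SMOOTHED RELATIVE ENTROPY of a population's velocity law with respect to the Maxwellian with its own mean and (smoothed)
temperature: `∫ f̂ log (f̂ / M_{1, u, θ + ϑ²})`, `≥ 0`, small iff the population is near-Maxwellian at resolution `ϑ`. -/
def relEnt {N : ℕ} (ϑ : ℝ) (w : Phase N) (P : Finset (Fin (N + 1))) : ℝ :=
  ∫ v : V3, kde ϑ w P v * Real.log (kde ϑ w P v / localMaxwellian 1 (temp w P + ϑ ^ 2) (meanVel w P) v)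

/-- INHOMOGENEITY of a cell in its neighbourhood: `L¹` distance of the two smoothed velocity laws. -/
def inhom {N : ℕ} (ϑ : ℝ) (w : Phase N) (P Q : Finset (Fin (N + 1))) : ℝ :=
  ∫ v : V3, |kde ϑ w P v - kde ϑ w Q v|

/-- OVER-PACKED neighbourhood: the spheres of the `4cℓ`-neighbourhood of `q` occupy a PACKING FRACTION larger than the
absolute constant `φs` (volume of the spheres `card · (π/6) ε_N³` against the volume of the `4cℓ`-ball). The packing cutoff
of TRIAGE-r2-1 sharpen 2 (i): in packed cells the one-step expansion `ℓ_loc/ε` fails (crystalline / jammed atoms have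
anisotropic contact directions, an `O(1)` defect). Typical packing under local Gibbs data is `ρ (π/6) σ³ ≪ φs` for `σ` small. -/
def Dense (φs c σ : ℝ) (N : ℕ) (w : Phase N) (q : Cell) : Prop :=
  φs * (4 / 3 * Real.pi * (4 * (c * meanFreePath σ N)) ^ 3) <
    ((nbhd c σ N w q).card : ℝ) * (Real.pi / 6 * hsDiameter σ N ^ 3)

/-- REGULAR unit: neighbourhood not `φs`-packed and `ϑ`-homogeneous at smoothing `ϑs`. -/
def Regular (ϑs ϑ φs c σ : ℝ) (N : ℕ) (w : Phase N) (q : Cell) : Prop :=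
  ¬ Dense φs c σ N w q ∧ inhom ϑs w (pop c σ N w q) (nbhd c σ N w q) ≤ ϑ

/-- GOOD unit: regular and `ϑ`-near-Maxwellian (the local-equilibrium cutoff). -/
def GoodUnit (ϑs ϑ φs c σ : ℝ) (N : ℕ) (w : Phase N) (q : Cell) : Prop :=
  Regular ϑs ϑ φs c σ N w q ∧ relEnt ϑs w (pop c σ N w q) ≤ ϑ

/-- The smoothed relative entropy of cell `q` AT TIME `t` along the flow (Eulerian: the population present at time `t`). -/
def relEntAt (ϑs c σ : ℝ) (N : ℕ) (Φ : Flow σ N) (t : ℝ) (q : Cell) (z : Phase N) : ℝ :=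
  relEnt ϑs (Φ.flow t z) (pop c σ N (Φ.flow t z) q)

/-! ## §4 The mesoscopic filtration (countable alphabet; no collision times are recorded) -/

/-- ORDERED LIST OF COLLISION RECORDS of sphere `i` with times in `((k−1)Δ, kΔ]` (empty for `k = 0`), each reduced to
(partner LABEL, own binned pre-velocity, own binned post-velocity, partner's binned pre-velocity) — NO collision time is
recorded (a recorded link pins the pair's relative position only to `≍ cℓ_N |v' − w'| ≫ ε_N`, card §Cheapest falsifier (a) (ii));
read through the tree enumerators `nthCollisionTimeOf` / `nthPartnerOf` / `nthRecordOf` (collisions of `i` after time `0`,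
increasing on the good set). The mark `(ω, v_i⁻, v_j⁻)` of every collision and the ownership of the collision (partner's start
cell from the snapshot at `(k−1)Δ`) are functions of `i`'s own record and the past — no momentum matching is needed. -/
def jumps (b c σ : ℝ) (N : ℕ) (Φ : Flow σ N) (k : ℕ) (i : Fin (N + 1)) (z : Phase N) :
    List (Fin (N + 1) × Cell × Cell × Cell) :=
  let Δ := stepLen c σ N
  let cnt := Set.ncard (collisionTimesOf G3 (hsDiameter σ N) (fun t => Φ.flow t z) i ∩ Set.Ioc 0 ((k : ℝ) * Δ))
  ((List.range cnt).filter fun n => decide (((k : ℝ) - 1) * Δ < Φ.nthCollisionTimeOf i n z)).map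
    fun n => (Φ.nthPartnerOf i n z, velBin b (Φ.nthRecordOf i n z).preVel.1, velBin b (Φ.nthRecordOf i n z).postVel.1,
      velBin b (Φ.nthRecordOf i n z).preVel.2)

/-- One sphere's observation at a step boundary: (cell, velocity bin) now, and its reduced collision records of the step just ended. -/
abbrev Obs (N : ℕ) : Type := (Cell × Cell) × List (Fin (N + 1) × Cell × Cell × Cell)

/-- OBSERVATION AT TIME `kΔ` of all spheres (cut to the good set of the flow, off which the flow-level maps are junk, so
that the history maps are Borel whenever the flow is — as in crux 2's good-set cut). -/
def obs (b c σ : ℝ) (N : ℕ) (Φ : Flow σ N) (k : ℕ) (z : Phase N) : Fin (N + 1) → Obs N := fun i =>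
  if z ∈ Φ.good then
    ((cellOf c σ N ((Φ.flow ((k : ℝ) * stepLen c σ N) z) i).1,
      velBin b ((Φ.flow ((k : ℝ) * stepLen c σ N) z) i).2),
     jumps b c σ N Φ k i z)
  else ((0, 0), [])

/-- MESOSCOPIC HISTORY up to time `kΔ` as a function of the initial datum (the engine's `𝓕_k` is `MeasurableSpace.comap (hist …) ⊤`). -/
def hist (b c σ : ℝ) (N : ℕ) (Φ : Flow σ N) (k : ℕ) (z : Phase N) : Fin (k + 1) → Fin (N + 1) → Obs N :=
  fun j => obs b c σ N Φ j z

/-- SEQUENTIAL HISTORY for the owned unit `q` at step `k`: the past `𝓕_k` together with the step-`k` observations (at time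
`(k+1)Δ`) of the spheres whose start cell is lexicographically SMALLER than `q` (already revealed when `q` is forecast;
no collision owned by `q` involves such a sphere); the engine's `𝓕_{k,q}` is `MeasurableSpace.comap (seqHist …) ⊤`. -/
def seqHist (b c σ : ℝ) (N : ℕ) (Φ : Flow σ N) (k : ℕ) (q : Cell) (z : Phase N) :
    (Fin (k + 1) → Fin (N + 1) → Obs N) × (Fin (N + 1) → Option (Obs N)) :=
  (hist b c σ N Φ k z,
    fun i => if cellLT (obs b c σ N Φ k z i).1.1 q then some (obs b c σ N Φ (k + 1) z i) else none)

/-- END-CELL SEQUENTIAL HISTORY for the unit `q` at step `k` (v2, wave-1 S5 audit): the past `𝓕_k` together with the step-`k`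
observations (at time `(k+1)Δ`) of the spheres whose cell AT TIME `(k+1)Δ` is lexicographically smaller than `q` — the EULERIAN population
of `q` at `(k+1)Δ`, hence `relEntAt ((k+1)Δ) q`, is adapted to this revelation order and not to the start-cell one of `seqHist` (spheres
arrive from lex-larger cells); part (b) of `MesoConditionalEquidistribution` is conditioned on it. Cells are read through the
good-set-cut `obs` (wave-1 S6 audit R1: a literal `startCell` is uncut off the good set). -/
def seqHistEnd (b c σ : ℝ) (N : ℕ) (Φ : Flow σ N) (k : ℕ) (q : Cell) (z : Phase N) :
    (Fin (k + 1) → Fin (N + 1) → Obs N) × (Fin (N + 1) → Option (Obs N)) :=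
  (hist b c σ N Φ k z,
    fun i => if cellLT (obs b c σ N Φ (k + 1) z i).1.1 q then some (obs b c σ N Φ (k + 1) z i) else none)

/-- The data REVEALED RIGHT AFTER unit `(k, q)` in the start-cell order (v2, wave-1 S6 audit): the past and the step-`k` observations of
the spheres starting in cells `≤ₗₑₓ q` — the engine's `𝓕_{n(k,q)+1}`, to which the increment of unit `(k, q)` must be adapted. -/
def seqHistLE (b c σ : ℝ) (N : ℕ) (Φ : Flow σ N) (k : ℕ) (q : Cell) (z : Phase N) :
    (Fin (k + 1) → Fin (N + 1) → Obs N) × (Fin (N + 1) → Option (Obs N)) :=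
  (hist b c σ N Φ k z,
    fun i => if cellLT q (obs b c σ N Φ k z i).1.1 then none else some (obs b c σ N Φ (k + 1) z i))

/-- OSCILLATION OF THE UNIT DEFECT over the revealed-data atom of `z` (v2, wave-1 S6 audit; shadow file rc 0): how far the exact
`unitDefect` fails to be a function of the data revealed right after `(k, q)` — nonzero only through the unrevealed impact directions of
grazing collisions (kick below the bin width), the velocity tails (no uniform modulus of `Ψ`, `fluxAvg Ψ` at large speeds) and the
binning; `sSup ∅ = 0` off the good set's atoms. -/
def defectOsc (Ψ : V3 × V3 × V3 → ℝ) (b c σ : ℝ) (N : ℕ) (Φ : Flow σ N) (k : ℕ) (q : Cell) (z : Phase N) : ℝ :=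
  sSup ((fun z' => |unitDefect Ψ c σ N Φ k q z' - unitDefect Ψ c σ N Φ k q z|) ''
    (Φ.good ∩ {z' | seqHistLE b c σ N Φ k q z' = seqHistLE b c σ N Φ k q z}))


end Summit.AtomisticToContinuum.HydrodynamicLimit.Theorems.EquilibriumForecastLine

end
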